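import Mathlib
import Literature.ComputerArithmetic.Higham2002.Gamma
import HarnessLib

/-!
# The build-rounding model of the lineage-A block certificate, I: rounded trees and the `|·|`-companion

HONEST FRAMING: elementary rounding-error algebra over `ℝ` (finite trees of `+`/`×`, absolute values, powers of
`1 ± u`).  It types ENGINE.md §3 (iii) step (0) / `kit_build.py:cert_eigs` of the Y3 FLOW-DATA lineage-A engine `sntm`
(cell `pub-ymgap`, HOME/pub-ymgap-flow-eng-1/): every entry of the float Galerkin block `M` is produced by a tree of
rounded additions and multiplications from exact data, and the engine carries a second FLOAT run of the same tree on the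
absolute values of the data (`Mabs`, the «parallel `|·|`-accumulation»), then uses `|M − G| ≤ c·u·Mabs` entrywise.
What was an input of the typed chain (HOME/pub-ymgap-flow-eng-1/TYPED-CHAIN-A.md, «what stays an input (ii)») becomes
a theorem here, modulo the standard model of floating-point arithmetic itself (`fl(a ∘ b) = (a ∘ b)(1 + δ)`, `|δ| ≤ u`
— the per-node hypotheses `hδ` below; which IEEE binary64 kernels a run used, and its rounding COUNT, are the run's
audit witness, not a theorem):

* §1 `Shape ι ν` — the shape of such a computation (leaves = data slots `ι`, nodes = rounded `+`/`×` with rounding slots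
  `ν`); `eval x δ T` its value on data `x` with relative perturbations `δ`; `eval x 0 T` the exact value; `count T` the
  Higham rounding count (a sum passes `max + 1`, a product `Σ + 1`).
* §2 the three inequalities: (forward) `|eval x δ T − eval x 0 T| ≤ ((1+u)^count − 1) · eval |x| 0 T`
  [Higham2002ASNA, Lemma 3.1, the `θ_n` pattern of (3.4)]; (companion) on non-negative data the FLOAT run is itself a
  certified lower bound of the exact one, `(1−u)^count · eval x 0 T ≤ eval x δ' T` [Higham2002ASNA, §3.3, running
  error analysis]; (combination) the exact absolute accumulation may be replaced by the float one at the price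
  `((1+u)/(1−u))^count − 1`, and this constant is `≤ 3·c·u` whenever `count ≤ c`, `u ≤ 1/16`, `c·u ≤ 1/16` (via the
  tree's `Literature.ComputerArithmetic.Higham2002.one_add_pow_sub_one_le_gamma`).  The engine's documented constant
  `4·N·u` with `N ≥ c` dominates `3·c·u`.

The matrix side (symmetrisation `(M₀ + M₀ᵀ)/2`, the hand-over to `RitzDeflation.abs_eigenvalues₀_sub_le_of_entrywise`)
is the sibling file `FlowData/SymmetrisedBlockTransport.lean`.  Pointwise real algebra; no lattice number, continuum or
Clay statement is touched.

Namespace `Summit.Ventures.YMGap.FlowData.GalerkinRounding`.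

## References
* [Higham2002ASNA] N. J. Higham, *Accuracy and Stability of Numerical Algorithms*, 2nd ed., SIAM 2002 — §2.2 (the
  standard model (2.4)), §3.1 Lemma 3.1 and (3.4) (inner products), §3.3 (running error analysis: the computed
  absolute sum as its own bound), §3.4 Lemma 3.3, §3.5 (`|ΔA| ≤ γ_n |A|`).
-/

noncomputable section

open Finset

namespace Summit.Ventures.YMGap.FlowData

namespace GalerkinRounding

/-! ### §1 Shapes of rounded computations -/

/-- The shape of a floating-point computation built from exact data by binary additions and multiplications:
`leaf i` reads data slot `i`; `add n a b` / `mul n a b` combine two sub-computations and round once, the rounding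
slot being `n`. [cite: Higham2002ASNA, §2.2 (2.4)] -/
inductive Shape (ι ν : Type*) : Type _
  | leaf : ι → Shape ι ν
  | add : ν → Shape ι ν → Shape ι ν → Shape ι ν
  | mul : ν → Shape ι ν → Shape ι ν → Shape ι ν

variable {ι ν : Type*}

namespace Shape

/-- Value of a shape on data `x` when the node with slot `n` is perturbed by the relative error `δ n`
(standard model: `fl(a ∘ b) = (a ∘ b)(1 + δ)`); `eval x 0` is the exact value. [cite: Higham2002ASNA, §2.2 (2.4)] -/
def eval (x : ι → ℝ) (δ : ν → ℝ) : Shape ι ν → ℝ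
  | leaf i => x i
  | add n a b => (eval x δ a + eval x δ b) * (1 + δ n)
  | mul n a b => (eval x δ a * eval x δ b) * (1 + δ n)

/-- Higham's rounding count of a shape: the largest number of rounding factors `(1 + δ)` multiplying any single term
of the expanded result — additions contribute along one branch (`max`), multiplications along both (`+`).
[cite: Higham2002ASNA, Lemma 3.1] -/
def count : Shape ι ν → ℕ
  | leaf _ => 0
  | add _ a b => max (count a) (count b) + 1
  | mul _ a b => count a + count b + 1

/-- Unfolding `eval` at a leaf. [cite: Higham2002ASNA, §2.2 (2.4)] -/
@[simp] theorem eval_leaf (x : ι → ℝ) (δ : ν → ℝ) (i : ι) : eval x δ (leaf i : Shape ι ν) = x i := rfl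

/-- Unfolding `eval` at a sum node. [cite: Higham2002ASNA, §2.2 (2.4)] -/
@[simp] theorem eval_add (x : ι → ℝ) (δ : ν → ℝ) (n : ν) (a b : Shape ι ν) :
    eval x δ (add n a b) = (eval x δ a + eval x δ b) * (1 + δ n) := rfl

/-- Unfolding `eval` at a product node. [cite: Higham2002ASNA, §2.2 (2.4)] -/
@[simp] theorem eval_mul (x : ι → ℝ) (δ : ν → ℝ) (n : ν) (a b : Shape ι ν) :
    eval x δ (mul n a b) = (eval x δ a * eval x δ b) * (1 + δ n) := rfl

/-- A leaf carries no rounding. [cite: Higham2002ASNA, Lemma 3.1] -/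
@[simp] theorem count_leaf (i : ι) : count (leaf i : Shape ι ν) = 0 := rfl

/-- Rounding count of a sum node. [cite: Higham2002ASNA, Lemma 3.1] -/
@[simp] theorem count_add (n : ν) (a b : Shape ι ν) : count (add n a b) = max (count a) (count b) + 1 := rfl

/-- Rounding count of a product node. [cite: Higham2002ASNA, Lemma 3.1] -/
@[simp] theorem count_mul (n : ν) (a b : Shape ι ν) : count (mul n a b) = count a + count b + 1 := rfl

/-- A run on non-negative data with all rounding factors `1 + δ ≥ 0` is non-negative.
[cite: Higham2002ASNA, §3.3] -/
theorem eval_nonneg {x : ι → ℝ} (hx : ∀ i, 0 ≤ x i) {δ : ν → ℝ} (hδ : ∀ n, -1 ≤ δ n) :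
    ∀ T : Shape ι ν, 0 ≤ eval x δ T
  | leaf i => by simpa using hx i
  | add n a b => by
      have ha := eval_nonneg hx hδ a
      have hb := eval_nonneg hx hδ b
      have hn : 0 ≤ 1 + δ n := by linarith [hδ n]
      simp only [eval_add]
      positivity
  | mul n a b => by
      have ha := eval_nonneg hx hδ a
      have hb := eval_nonneg hx hδ b
      have hn : 0 ≤ 1 + δ n := by linarith [hδ n]
      simp only [eval_mul]
      positivity

/-- The exact value is dominated by the exact absolute accumulation (the same tree on `|x|`):
`|eval x 0 T| ≤ eval |x| 0 T`. [cite: Higham2002ASNA, §3.1] -/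
theorem abs_eval_zero_le : ∀ T : Shape ι ν, ∀ x : ι → ℝ, |eval x 0 T| ≤ eval (fun i => |x i|) 0 T
  | leaf i, x => by simp
  | add n a b, x => by
      have ha := abs_eval_zero_le a x
      have hb := abs_eval_zero_le b x
      simp only [eval_add, Pi.zero_apply, add_zero, mul_one]
      exact (abs_add_le _ _).trans (add_le_add ha hb)
  | mul n a b, x => by
      have ha := abs_eval_zero_le a x
      have hb := abs_eval_zero_le b x
      simp only [eval_mul, Pi.zero_apply, add_zero, mul_one]
      rw [abs_mul]
      exact mul_le_mul ha hb (abs_nonneg _) ((abs_nonneg _).trans ha)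

/-- The exact absolute accumulation is non-negative. [cite: Higham2002ASNA, §3.1] -/
theorem eval_abs_zero_nonneg (T : Shape ι ν) (x : ι → ℝ) : 0 ≤ eval (fun i => |x i|) 0 T :=
  (abs_nonneg _).trans (abs_eval_zero_le T x)

/-! ### §2 The forward bound, the float companion, and the combined constant -/

/-- **Forward error of a rounded tree (Higham's `θ`-pattern).** If every rounding slot carries a relative error
`|δ n| ≤ u` (`u ≥ 0`), then `|fl − exact| ≤ ((1+u)^count − 1) · (exact absolute accumulation)`.  For a recursive sum
of `n` rounded products of `k` factors this is the familiar `γ_{n+k−1}`-type bound before the passage to `γ`.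
[cite: Higham2002ASNA, Lemma 3.1] -/
theorem abs_eval_sub_eval_zero_le {u : ℝ} (hu : 0 ≤ u) {δ : ν → ℝ} (hδ : ∀ n, |δ n| ≤ u) (x : ι → ℝ) :
    ∀ T : Shape ι ν,
      |eval x δ T - eval x 0 T| ≤ ((1 + u) ^ count T - 1) * eval (fun i => |x i|) 0 T
  | leaf i => by simp
  | add n a b => by
      have iha := abs_eval_sub_eval_zero_le hu hδ x a
      have ihb := abs_eval_sub_eval_zero_le hu hδ x b
      simp only [eval_add, count_add, Pi.zero_apply, add_zero, mul_one]
      set fa := eval x δ a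
      set fb := eval x δ b
      set ea := eval x 0 a
      set eb := eval x 0 b
      set Aa := eval (fun i => |x i|) 0 a
      set Ab := eval (fun i => |x i|) 0 b
      set d := δ n
      set P := (1 + u) ^ max (count a) (count b) with hP
      have h1u : 1 ≤ 1 + u := by linarith
      have hAa : 0 ≤ Aa := eval_abs_zero_nonneg a x
      have hAb : 0 ≤ Ab := eval_abs_zero_nonneg b x
      have hea : |ea| ≤ Aa := abs_eval_zero_le a x
      have heb : |eb| ≤ Ab := abs_eval_zero_le b x
      have hPa : (1 + u) ^ count a ≤ P := pow_le_pow_right₀ h1u (le_max_left _ _)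
      have hPb : (1 + u) ^ count b ≤ P := pow_le_pow_right₀ h1u (le_max_right _ _)
      have hd : |d| ≤ u := hδ n
      have hd' : |1 + d| ≤ 1 + u := by
        rw [abs_le] at hd ⊢; constructor <;> linarith [hd.1, hd.2]
      have iha' : |fa - ea| ≤ (P - 1) * Aa := iha.trans (mul_le_mul_of_nonneg_right (by linarith) hAa)
      have ihb' : |fb - eb| ≤ (P - 1) * Ab := ihb.trans (mul_le_mul_of_nonneg_right (by linarith) hAb)
      have e1 : (fa + fb) * (1 + d) - (ea + eb) = ((fa - ea) + (fb - eb)) * (1 + d) + d * (ea + eb) := by ring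
      have h1 : |((fa - ea) + (fb - eb)) * (1 + d)| ≤ ((P - 1) * Aa + (P - 1) * Ab) * (1 + u) := by
        rw [abs_mul]
        refine mul_le_mul ((abs_add_le _ _).trans (add_le_add iha' ihb')) hd' (abs_nonneg _) ?_
        have hP1 : 0 ≤ P - 1 := by linarith [one_le_pow₀ (n := max (count a) (count b)) h1u]
        positivity
      have h2 : |d * (ea + eb)| ≤ u * (Aa + Ab) := by
        rw [abs_mul]
        exact mul_le_mul hd ((abs_add_le _ _).trans (add_le_add hea heb)) (abs_nonneg _) hu
      rw [e1, pow_succ]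
      calc |((fa - ea) + (fb - eb)) * (1 + d) + d * (ea + eb)|
          ≤ |((fa - ea) + (fb - eb)) * (1 + d)| + |d * (ea + eb)| := abs_add_le _ _
        _ ≤ ((P - 1) * Aa + (P - 1) * Ab) * (1 + u) + u * (Aa + Ab) := add_le_add h1 h2
        _ = (P * (1 + u) - 1) * (Aa + Ab) := by ring
  | mul n a b => by
      have iha := abs_eval_sub_eval_zero_le hu hδ x a
      have ihb := abs_eval_sub_eval_zero_le hu hδ x b
      simp only [eval_mul, count_mul, Pi.zero_apply, add_zero, mul_one]
      set fa := eval x δ a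
      set fb := eval x δ b
      set ea := eval x 0 a
      set eb := eval x 0 b
      set Aa := eval (fun i => |x i|) 0 a
      set Ab := eval (fun i => |x i|) 0 b
      set d := δ n
      set Pa := (1 + u) ^ count a
      set Pb := (1 + u) ^ count b
      have h1u : 1 ≤ 1 + u := by linarith
      have hAa : 0 ≤ Aa := eval_abs_zero_nonneg a x
      have hAb : 0 ≤ Ab := eval_abs_zero_nonneg b x
      have hea : |ea| ≤ Aa := abs_eval_zero_le a x
      have heb : |eb| ≤ Ab := abs_eval_zero_le b x
      have hPa1 : 1 ≤ Pa := one_le_pow₀ h1u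
      have hPb1 : 1 ≤ Pb := one_le_pow₀ h1u
      have hd : |d| ≤ u := hδ n
      have hd' : |1 + d| ≤ 1 + u := by
        rw [abs_le] at hd ⊢; constructor <;> linarith [hd.1, hd.2]
      -- `|fb| ≤ Pb · Ab`
      have hfb : |fb| ≤ Pb * Ab := by
        have : |fb| ≤ |fb - eb| + |eb| := by
          calc |fb| = |(fb - eb) + eb| := by ring_nf
            _ ≤ |fb - eb| + |eb| := abs_add_le _ _
        calc |fb| ≤ (Pb - 1) * Ab + Ab := this.trans (add_le_add ihb heb)
          _ = Pb * Ab := by ring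
      have e1 : fa * fb * (1 + d) - ea * eb = ((fa - ea) * fb + ea * (fb - eb)) * (1 + d) + d * (ea * eb) := by
        ring
      have h3 : |(fa - ea) * fb| ≤ (Pa - 1) * Aa * (Pb * Ab) := by
        rw [abs_mul]
        exact mul_le_mul iha hfb (abs_nonneg _) (by nlinarith)
      have h4 : |ea * (fb - eb)| ≤ Aa * ((Pb - 1) * Ab) := by
        rw [abs_mul]
        exact mul_le_mul hea ihb (abs_nonneg _) hAa
      have h1 : |((fa - ea) * fb + ea * (fb - eb)) * (1 + d)| ≤
          ((Pa - 1) * Aa * (Pb * Ab) + Aa * ((Pb - 1) * Ab)) * (1 + u) := by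
        rw [abs_mul]
        refine mul_le_mul ((abs_add_le _ _).trans (add_le_add h3 h4)) hd' (abs_nonneg _) ?_
        have : 0 ≤ Pa - 1 := by linarith
        have : 0 ≤ Pb - 1 := by linarith
        positivity
      have h2 : |d * (ea * eb)| ≤ u * (Aa * Ab) := by
        rw [abs_mul, abs_mul]
        exact mul_le_mul hd (mul_le_mul hea heb (abs_nonneg _) hAa) (by positivity) hu
      rw [e1, pow_succ, pow_add]
      calc |((fa - ea) * fb + ea * (fb - eb)) * (1 + d) + d * (ea * eb)|
          ≤ |((fa - ea) * fb + ea * (fb - eb)) * (1 + d)| + |d * (ea * eb)| := abs_add_le _ _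
        _ ≤ ((Pa - 1) * Aa * (Pb * Ab) + Aa * ((Pb - 1) * Ab)) * (1 + u) + u * (Aa * Ab) := add_le_add h1 h2
        _ = (Pa * Pb * (1 + u) - 1) * (Aa * Ab) := by ring

/-- **The float companion is a lower bound.** On non-negative data, a run of the tree with rounding factors
`|δ' n| ≤ u ≤ 1` under-estimates the exact value by at most the factor `(1−u)^count`:
`(1−u)^count · eval x 0 T ≤ eval x δ' T`.  This is why the engine may divide by its FLOAT `Mabs`.
[cite: Higham2002ASNA, §3.3] -/
theorem pow_mul_eval_zero_le_eval {u : ℝ} (hu1 : u ≤ 1) {x : ι → ℝ} (hx : ∀ i, 0 ≤ x i) {δ : ν → ℝ}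
    (hδ : ∀ n, |δ n| ≤ u) : ∀ T : Shape ι ν, (1 - u) ^ count T * eval x 0 T ≤ eval x δ T
  | leaf i => by simp
  | add n a b => by
      have iha := pow_mul_eval_zero_le_eval hu1 hx hδ a
      have ihb := pow_mul_eval_zero_le_eval hu1 hx hδ b
      have hδ1 : ∀ n, -1 ≤ δ n := fun n => by linarith [(abs_le.mp (hδ n)).1]
      simp only [eval_add, count_add, Pi.zero_apply, add_zero, mul_one]
      have hu0 : 0 ≤ u := (abs_nonneg _).trans (hδ n)
      have h0u : 0 ≤ 1 - u := by linarith
      have hea : 0 ≤ eval x 0 a := eval_nonneg hx (fun _ => by simp) a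
      have heb : 0 ≤ eval x 0 b := eval_nonneg hx (fun _ => by simp) b
      have hfa : 0 ≤ eval x δ a := eval_nonneg hx hδ1 a
      have hfb : 0 ≤ eval x δ b := eval_nonneg hx hδ1 b
      have hQa : (1 - u) ^ max (count a) (count b) ≤ (1 - u) ^ count a :=
        pow_le_pow_of_le_one h0u (by linarith) (le_max_left _ _)
      have hQb : (1 - u) ^ max (count a) (count b) ≤ (1 - u) ^ count b :=
        pow_le_pow_of_le_one h0u (by linarith) (le_max_right _ _)
      have ha' : (1 - u) ^ max (count a) (count b) * eval x 0 a ≤ eval x δ a :=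
        (mul_le_mul_of_nonneg_right hQa hea).trans iha
      have hb' : (1 - u) ^ max (count a) (count b) * eval x 0 b ≤ eval x δ b :=
        (mul_le_mul_of_nonneg_right hQb heb).trans ihb
      have hd : 1 - u ≤ 1 + δ n := by linarith [(abs_le.mp (hδ n)).1]
      rw [pow_succ]
      calc (1 - u) ^ max (count a) (count b) * (1 - u) * (eval x 0 a + eval x 0 b)
          = ((1 - u) ^ max (count a) (count b) * eval x 0 a
              + (1 - u) ^ max (count a) (count b) * eval x 0 b) * (1 - u) := by ring
        _ ≤ (eval x δ a + eval x δ b) * (1 + δ n) :=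
            mul_le_mul (add_le_add ha' hb') hd h0u (add_nonneg hfa hfb)
  | mul n a b => by
      have iha := pow_mul_eval_zero_le_eval hu1 hx hδ a
      have ihb := pow_mul_eval_zero_le_eval hu1 hx hδ b
      have hδ1 : ∀ n, -1 ≤ δ n := fun n => by linarith [(abs_le.mp (hδ n)).1]
      simp only [eval_mul, count_mul, Pi.zero_apply, add_zero, mul_one]
      have h0u : 0 ≤ 1 - u := by linarith
      have hea : 0 ≤ eval x 0 a := eval_nonneg hx (fun _ => by simp) a
      have heb : 0 ≤ eval x 0 b := eval_nonneg hx (fun _ => by simp) b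
      have hfa : 0 ≤ eval x δ a := eval_nonneg hx hδ1 a
      have hfb : 0 ≤ eval x δ b := eval_nonneg hx hδ1 b
      have hd : 1 - u ≤ 1 + δ n := by linarith [(abs_le.mp (hδ n)).1]
      rw [pow_succ, pow_add]
      calc (1 - u) ^ count a * (1 - u) ^ count b * (1 - u) * (eval x 0 a * eval x 0 b)
          = ((1 - u) ^ count a * eval x 0 a) * ((1 - u) ^ count b * eval x 0 b) * (1 - u) := by ring
        _ ≤ (eval x δ a * eval x δ b) * (1 + δ n) :=
            mul_le_mul (mul_le_mul iha ihb (by positivity) hfa) hd h0u (mul_nonneg hfa hfb)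

/-- **Forward bound with the FLOAT absolute accumulation.** With rounding errors `|δ n| ≤ u` in the signed run and
`|δ' n| ≤ u` in the absolute run (`0 ≤ u < 1`):
`|eval x δ T − eval x 0 T| ≤ (((1+u)/(1−u))^count − 1) · eval |x| δ' T`. [cite: Higham2002ASNA, Lemma 3.1] -/
theorem abs_eval_sub_eval_zero_le_absRun {u : ℝ} (hu : 0 ≤ u) (hu1 : u < 1) {δ δ' : ν → ℝ}
    (hδ : ∀ n, |δ n| ≤ u) (hδ' : ∀ n, |δ' n| ≤ u) (x : ι → ℝ) (T : Shape ι ν) :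
    |eval x δ T - eval x 0 T| ≤ (((1 + u) / (1 - u)) ^ count T - 1) * eval (fun i => |x i|) δ' T := by
  set c := count T
  set A := eval (fun i => |x i|) 0 T
  set A' := eval (fun i => |x i|) δ' T
  have h1u : 0 < 1 - u := by linarith
  have hA : 0 ≤ A := eval_abs_zero_nonneg T x
  have hδ'1 : ∀ n, -1 ≤ δ' n := fun n => by linarith [(abs_le.mp (hδ' n)).1]
  have hA' : 0 ≤ A' := eval_nonneg (fun i => abs_nonneg (x i)) hδ'1 T
  have hfwd := abs_eval_sub_eval_zero_le hu hδ x T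
  have hcomp : (1 - u) ^ c * A ≤ A' := pow_mul_eval_zero_le_eval hu1.le (fun i => abs_nonneg (x i)) hδ' T
  have hq : 0 < (1 - u) ^ c := pow_pos h1u c
  have hP1 : 1 ≤ (1 + u) ^ c := one_le_pow₀ (by linarith)
  -- `A ≤ A' / (1-u)^c`
  have hA_le : A ≤ A' / (1 - u) ^ c := by
    rw [le_div_iff₀ hq]; linarith [mul_comm ((1 - u) ^ c) A]
  have hinv1 : 1 ≤ ((1 - u) ^ c)⁻¹ := by
    rw [one_le_inv₀ hq]
    exact pow_le_one₀ h1u.le (by linarith)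
  calc |eval x δ T - eval x 0 T| ≤ ((1 + u) ^ c - 1) * A := hfwd
    _ ≤ ((1 + u) ^ c - 1) * (A' / (1 - u) ^ c) := mul_le_mul_of_nonneg_left hA_le (by linarith)
    _ = ((1 + u) ^ c * ((1 - u) ^ c)⁻¹ - ((1 - u) ^ c)⁻¹) * A' := by ring
    _ ≤ ((1 + u) ^ c * ((1 - u) ^ c)⁻¹ - 1) * A' := by
        apply mul_le_mul_of_nonneg_right _ hA'
        linarith
    _ = (((1 + u) / (1 - u)) ^ c - 1) * A' := by rw [div_pow, div_eq_mul_inv]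

/-- **The linear constant.** For `0 ≤ u ≤ 1/16` and `c·u ≤ 1/16`: `((1+u)/(1−u))^c − 1 ≤ 3·c·u`
(`(1+u)/(1−u) = 1 + v`, `v = 2u/(1−u) ≤ 32u/15`, then the tree's `(1+v)^c − 1 ≤ γ_c(v) = cv/(1−cv)` with
`cv ≤ 2/15`). [cite: Higham2002ASNA, Lemma 3.1; Lemma 3.3] -/
theorem ratio_pow_sub_one_le {u : ℝ} (hu : 0 ≤ u) (hu16 : u ≤ 1 / 16) {c : ℕ} (hc : (c : ℝ) * u ≤ 1 / 16) :
    ((1 + u) / (1 - u)) ^ c - 1 ≤ 3 * c * u := by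
  have h1u : 0 < 1 - u := by linarith
  set v := 2 * u / (1 - u) with hv
  have hv0 : 0 ≤ v := div_nonneg (by linarith) h1u.le
  have hratio : (1 + u) / (1 - u) = 1 + v := by
    rw [hv]; field_simp; ring
  have hvle : v ≤ 32 / 15 * u := by
    rw [hv, div_le_iff₀ h1u]; nlinarith
  have hc0 : (0 : ℝ) ≤ c := Nat.cast_nonneg c
  have hcv : (c : ℝ) * v ≤ 2 / 15 := by
    calc (c : ℝ) * v ≤ c * (32 / 15 * u) := mul_le_mul_of_nonneg_left hvle hc0
      _ = 32 / 15 * (c * u) := by ring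
      _ ≤ 32 / 15 * (1 / 16) := by gcongr
      _ = 2 / 15 := by norm_num
  have hcv1 : (c : ℝ) * v < 1 := by linarith
  have hγ := Literature.ComputerArithmetic.Higham2002.one_add_pow_sub_one_le_gamma hv0 hcv1
  rw [hratio]
  refine hγ.trans ?_
  unfold Literature.ComputerArithmetic.Higham2002.gamma
  rw [div_le_iff₀ (by linarith)]
  nlinarith [mul_nonneg hc0 hu, mul_nonneg hc0 hv0]

/-- **Engine form of the entry bound.** If the shape's rounding count is `≤ c`, all `|δ|, |δ'| ≤ u`, `u ≤ 1/16` and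
`c·u ≤ 1/16`, then `|fl − exact| ≤ 3·c·u · (float absolute accumulation)`; the engine's documented constant
`4·(N)·u` with `N ≥ c` dominates this. [cite: Higham2002ASNA, Lemma 3.1; §3.3] -/
theorem abs_eval_sub_eval_zero_le_linear {u : ℝ} (hu : 0 ≤ u) (hu16 : u ≤ 1 / 16) {c : ℕ}
    (hc : (c : ℝ) * u ≤ 1 / 16) {δ δ' : ν → ℝ} (hδ : ∀ n, |δ n| ≤ u) (hδ' : ∀ n, |δ' n| ≤ u) (x : ι → ℝ)
    (T : Shape ι ν) (hT : count T ≤ c) :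
    |eval x δ T - eval x 0 T| ≤ 3 * c * u * eval (fun i => |x i|) δ' T := by
  have hu1 : u < 1 := by linarith
  have hδ'1 : ∀ n, -1 ≤ δ' n := fun n => by linarith [(abs_le.mp (hδ' n)).1]
  have hA' : 0 ≤ eval (fun i => |x i|) δ' T := eval_nonneg (fun i => abs_nonneg (x i)) hδ'1 T
  refine (abs_eval_sub_eval_zero_le_absRun hu hu1 hδ hδ' x T).trans (mul_le_mul_of_nonneg_right ?_ hA')
  have h1u : 0 < 1 - u := by linarith
  have hbase : 1 ≤ (1 + u) / (1 - u) := by rw [one_le_div h1u]; linarith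
  have hmono : ((1 + u) / (1 - u)) ^ count T ≤ ((1 + u) / (1 - u)) ^ c := pow_le_pow_right₀ hbase hT
  linarith [ratio_pow_sub_one_le hu hu16 hc]

end Shape


end GalerkinRounding

end Summit.Ventures.YMGap.FlowData

end
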